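import Mathlib
import HarnessLib
import Summits.HubbardSuperconductivity.HubbardSuperconductivity.Theorems.KLProgrammePerturbedFermiCurveTwoFrameTower3

/-!
# Route `KLProgramme` — TWO polar level curves, order FOUR: `|v⁗ − u⁗|` linear in the differences of the derivatives of the two level
# functions at the two curve points (the fifteen-term identity, two solves; (E3a-MS), frame side)

Cell `gate-hubbard-kl`, seat hubbard-kl-k3c3-p3 (g3; row «implicit-function / monotonicity route»).  Completes the pointwise two-curve
algebra of `…TwoFrameTower` (p490050, orders 1–2) and `…TwoFrameTower3` (order 3) at order four, in the style of p476128's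
`abs_top_le_of_level_four`: the fifteen multilinear terms of `level_chain_four` for the two curves are subtracted term by term
(`abs_apply{₂,₃,₄}_sub_le'`) and the top radial coefficients compared by `abs_sub_of_two_solves`.  For the ENGINE child's two-leg stubs
(stmt-HubbardSuperconductivity-19855), clause (E3a-MS) `TwoLegSizesMST` — the slot-`m` part of the scale-`n` piece is a difference of one
increment read on the curves of two nearby frames (HOME/hubbard-kl-k3c3-p3/MS-CUT.md §3): its order-4 size needs `|v⁗ − u⁗|`.

* `abs_top_sub_top_le_of_level_four` (abstract two-solve bound; coefficients `1, 6, 3, 4` as in Faà di Bruno);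
* `abs_deriv_four_sub_le_of_polar_levels`: for `C⁴` `e, e′` with polar curves `u•dir`, `v•dir`: `|v⁗ θ − u⁗ θ|` in terms of the lower
  differences `W₀ … W₃`, the derivative differences `Δ₁ … Δ₄` at the two points, the sizes `E₁ … E₄` of `e`'s derivatives at `p`, the common
  tower bounds `U₀, R₁, R₂, R₃` and `R₄ ≥ |u⁗ θ|`, and the transversality `ρ₀` of the second curve.  In the band instantiation `Δ₄` carries
  the one NON-Lipschitz term `2κ₄` (`D⁴` of the frame is bounded, not Lipschitz, under `FrameOK`), affordable in the slot budget (MS-CUT §5).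

Everything is PROVED; no definitions; nothing about the Hubbard model.  References: BGM 2006 §2.4 Lemma 2.1 (2.40)
[cite: BenfattoGiulianiMastropietro2006]; FST IV (CPAM 53 (2000) 1350) Thm 2.
-/

noncomputable section

namespace Summit.HubbardSuperconductivity.HubbardSuperconductivity.Theorems.PerturbedFermiCurve

set_option linter.dupNamespace false -- summit = problem name (single-conjunct summit), D-0017
set_option maxSynthPendingDepth 3 -- nested operator-norm instances (third/fourth Fréchet derivatives)

open Real Set
open Literature.MathematicalPhysics.QuantumLattice Literature.MathematicalPhysics.QuantumLattice.BandSectorCounting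

/-! ## §1 The abstract two-solve bound for the fifteen-term identity -/

section Algebra

variable {V : Type*} [NormedAddCommGroup V] [NormedSpace ℝ V]

/-- **Order 4, two solves.**  Both fifteen-term identities (shape of `level_chain_four`), `v₄ = s•d + r`, `ṽ₄ = s̃•d + r̃`, `Ã₁ d ≥ ρ₀ > 0`,
`‖d‖ ≤ 1`; sizes `‖A_k‖ ≤ E_k`, differences `‖Ã_k − A_k‖ ≤ Δ_k` (k ≤ 4); `‖v_j‖, ‖ṽ_j‖ ≤ K_j`, `‖ṽ_j − v_j‖ ≤ δ_j` (j ≤ 3); `‖r̃‖ ≤ L`,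
`‖r̃ − r‖ ≤ dL`, `|s| ≤ S`:
`|s̃ − s| ≤ (Δ₄K₁⁴ + 4E₄δ₁K₁³ + 6(Δ₃K₁²K₂ + E₃(δ₂K₁² + 2K₁K₂δ₁)) + 3(Δ₂K₂² + 2E₂K₂δ₂) + 4(Δ₂K₁K₃ + E₂(δ₁K₃ + K₁δ₃)) + Δ₁L + E₁dL + SΔ₁)/ρ₀`.
[folklore] -/
theorem abs_top_sub_top_le_of_level_four {A₁ Ã₁ : V →L[ℝ] ℝ} {A₂ Ã₂ : V →L[ℝ] V →L[ℝ] ℝ} {A₃ Ã₃ : V →L[ℝ] V →L[ℝ] V →L[ℝ] ℝ}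
    {A₄ Ã₄ : V →L[ℝ] V →L[ℝ] V →L[ℝ] V →L[ℝ] ℝ}
    {v₁ v₂ v₃ v₄ w₁ w₂ w₃ w₄ d r r' : V} {s s' ρ₀ E₁ E₂ E₃ E₄ Δ₁ Δ₂ Δ₃ Δ₄ K₁ K₂ K₃ δ₁ δ₂ δ₃ L dL S : ℝ}
    (hid : A₄ v₁ v₁ v₁ v₁ + A₃ v₂ v₁ v₁ + A₃ v₁ v₂ v₁ + A₃ v₁ v₁ v₂ + (A₃ v₁ v₂ v₁ + A₂ v₃ v₁ + A₂ v₂ v₂) +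
        (A₃ v₁ v₁ v₂ + A₂ v₂ v₂ + A₂ v₁ v₃) + (A₃ v₁ v₁ v₂ + A₂ v₂ v₂ + A₂ v₁ v₃) + (A₂ v₁ v₃ + A₁ v₄) = 0)
    (hid' : Ã₄ w₁ w₁ w₁ w₁ + Ã₃ w₂ w₁ w₁ + Ã₃ w₁ w₂ w₁ + Ã₃ w₁ w₁ w₂ + (Ã₃ w₁ w₂ w₁ + Ã₂ w₃ w₁ + Ã₂ w₂ w₂) +
        (Ã₃ w₁ w₁ w₂ + Ã₂ w₂ w₂ + Ã₂ w₁ w₃) + (Ã₃ w₁ w₁ w₂ + Ã₂ w₂ w₂ + Ã₂ w₁ w₃) + (Ã₂ w₁ w₃ + Ã₁ w₄) = 0)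
    (hv : v₄ = s • d + r) (hw : w₄ = s' • d + r') (hρ' : ρ₀ ≤ Ã₁ d) (hρ0 : 0 < ρ₀) (hd : ‖d‖ ≤ 1)
    (hE₁ : ‖A₁‖ ≤ E₁) (hE₂ : ‖A₂‖ ≤ E₂) (hE₃ : ‖A₃‖ ≤ E₃) (hE₄ : ‖A₄‖ ≤ E₄)
    (hΔ₁ : ‖Ã₁ - A₁‖ ≤ Δ₁) (hΔ₂ : ‖Ã₂ - A₂‖ ≤ Δ₂) (hΔ₃ : ‖Ã₃ - A₃‖ ≤ Δ₃) (hΔ₄ : ‖Ã₄ - A₄‖ ≤ Δ₄)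
    (hK₁ : ‖v₁‖ ≤ K₁) (hK₁' : ‖w₁‖ ≤ K₁) (hK₂ : ‖v₂‖ ≤ K₂) (hK₂' : ‖w₂‖ ≤ K₂) (hK₃ : ‖v₃‖ ≤ K₃) (hK₃' : ‖w₃‖ ≤ K₃)
    (hδ₁ : ‖w₁ - v₁‖ ≤ δ₁) (hδ₂ : ‖w₂ - v₂‖ ≤ δ₂) (hδ₃ : ‖w₃ - v₃‖ ≤ δ₃) (hL : ‖r'‖ ≤ L) (hdL : ‖r' - r‖ ≤ dL) (hS : |s| ≤ S) :
    |s' - s| ≤ (Δ₄ * K₁ ^ 4 + 4 * E₄ * δ₁ * K₁ ^ 3 + 6 * (Δ₃ * K₁ ^ 2 * K₂ + E₃ * (δ₂ * K₁ ^ 2 + 2 * K₁ * K₂ * δ₁)) +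
      3 * (Δ₂ * K₂ ^ 2 + 2 * E₂ * K₂ * δ₂) + 4 * (Δ₂ * K₁ * K₃ + E₂ * (δ₁ * K₃ + K₁ * δ₃)) + Δ₁ * L + E₁ * dL + S * Δ₁) / ρ₀ := by
  have hΔ10 : 0 ≤ Δ₁ := (Ã₁ - A₁).opNorm_nonneg.trans hΔ₁
  rw [hv, map_add, map_smul, smul_eq_mul] at hid
  rw [hw, map_add, map_smul, smul_eq_mul] at hid'
  have h : s * A₁ d = -(A₄ v₁ v₁ v₁ v₁ + A₃ v₂ v₁ v₁ + A₃ v₁ v₂ v₁ + A₃ v₁ v₁ v₂ + (A₃ v₁ v₂ v₁ + A₂ v₃ v₁ + A₂ v₂ v₂) +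
      (A₃ v₁ v₁ v₂ + A₂ v₂ v₂ + A₂ v₁ v₃) + (A₃ v₁ v₁ v₂ + A₂ v₂ v₂ + A₂ v₁ v₃) + A₂ v₁ v₃ + A₁ r) := by linarith
  have h' : s' * Ã₁ d = -(Ã₄ w₁ w₁ w₁ w₁ + Ã₃ w₂ w₁ w₁ + Ã₃ w₁ w₂ w₁ + Ã₃ w₁ w₁ w₂ + (Ã₃ w₁ w₂ w₁ + Ã₂ w₃ w₁ + Ã₂ w₂ w₂) +
      (Ã₃ w₁ w₁ w₂ + Ã₂ w₂ w₂ + Ã₂ w₁ w₃) + (Ã₃ w₁ w₁ w₂ + Ã₂ w₂ w₂ + Ã₂ w₁ w₃) + Ã₂ w₁ w₃ + Ã₁ r') := by linarith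
  have hsol := abs_sub_of_two_solves h h' hρ' hρ0
  -- the fifteen term differences
  have t4 : |Ã₄ w₁ w₁ w₁ w₁ - A₄ v₁ v₁ v₁ v₁| ≤ Δ₄ * K₁ ^ 4 + 4 * E₄ * δ₁ * K₁ ^ 3 := abs_apply₄_sub_le' hΔ₄ hE₄ hK₁ hK₁' hδ₁
  have t3a : |Ã₃ w₂ w₁ w₁ - A₃ v₂ v₁ v₁| ≤ Δ₃ * K₂ * K₁ * K₁ + E₃ * (δ₂ * K₁ * K₁ + K₂ * δ₁ * K₁ + K₂ * K₁ * δ₁) :=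
    abs_apply₃_sub_le' hΔ₃ hE₃ hK₂ hK₂' hK₁ hK₁' hK₁' hδ₂ hδ₁ hδ₁
  have t3b : |Ã₃ w₁ w₂ w₁ - A₃ v₁ v₂ v₁| ≤ Δ₃ * K₁ * K₂ * K₁ + E₃ * (δ₁ * K₂ * K₁ + K₁ * δ₂ * K₁ + K₁ * K₂ * δ₁) :=
    abs_apply₃_sub_le' hΔ₃ hE₃ hK₁ hK₁' hK₂ hK₂' hK₁' hδ₁ hδ₂ hδ₁
  have t3c : |Ã₃ w₁ w₁ w₂ - A₃ v₁ v₁ v₂| ≤ Δ₃ * K₁ * K₁ * K₂ + E₃ * (δ₁ * K₁ * K₂ + K₁ * δ₁ * K₂ + K₁ * K₁ * δ₂) :=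
    abs_apply₃_sub_le' hΔ₃ hE₃ hK₁ hK₁' hK₁ hK₁' hK₂' hδ₁ hδ₁ hδ₂
  have t31 : |Ã₂ w₃ w₁ - A₂ v₃ v₁| ≤ Δ₂ * K₃ * K₁ + E₂ * (δ₃ * K₁ + K₃ * δ₁) := abs_apply₂_sub_le' hΔ₂ hE₂ hK₃ hK₃' hK₁' hδ₃ hδ₁
  have t13 : |Ã₂ w₁ w₃ - A₂ v₁ v₃| ≤ Δ₂ * K₁ * K₃ + E₂ * (δ₁ * K₃ + K₁ * δ₃) := abs_apply₂_sub_le' hΔ₂ hE₂ hK₁ hK₁' hK₃' hδ₁ hδ₃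
  have t22 : |Ã₂ w₂ w₂ - A₂ v₂ v₂| ≤ Δ₂ * K₂ * K₂ + E₂ * (δ₂ * K₂ + K₂ * δ₂) := abs_apply₂_sub_le' hΔ₂ hE₂ hK₂ hK₂' hK₂' hδ₂ hδ₂
  have t1 : |Ã₁ r' - A₁ r| ≤ Δ₁ * L + E₁ * dL := abs_apply_sub_le' hΔ₁ hE₁ hL hdL
  have e : Ã₄ w₁ w₁ w₁ w₁ + Ã₃ w₂ w₁ w₁ + Ã₃ w₁ w₂ w₁ + Ã₃ w₁ w₁ w₂ + (Ã₃ w₁ w₂ w₁ + Ã₂ w₃ w₁ + Ã₂ w₂ w₂) +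
        (Ã₃ w₁ w₁ w₂ + Ã₂ w₂ w₂ + Ã₂ w₁ w₃) + (Ã₃ w₁ w₁ w₂ + Ã₂ w₂ w₂ + Ã₂ w₁ w₃) + Ã₂ w₁ w₃ + Ã₁ r' -
      (A₄ v₁ v₁ v₁ v₁ + A₃ v₂ v₁ v₁ + A₃ v₁ v₂ v₁ + A₃ v₁ v₁ v₂ + (A₃ v₁ v₂ v₁ + A₂ v₃ v₁ + A₂ v₂ v₂) +
        (A₃ v₁ v₁ v₂ + A₂ v₂ v₂ + A₂ v₁ v₃) + (A₃ v₁ v₁ v₂ + A₂ v₂ v₂ + A₂ v₁ v₃) + A₂ v₁ v₃ + A₁ r) =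
      (Ã₄ w₁ w₁ w₁ w₁ - A₄ v₁ v₁ v₁ v₁) + (Ã₃ w₂ w₁ w₁ - A₃ v₂ v₁ v₁) + (Ã₃ w₁ w₂ w₁ - A₃ v₁ v₂ v₁) +
        (Ã₃ w₁ w₁ w₂ - A₃ v₁ v₁ v₂) +
        ((Ã₃ w₁ w₂ w₁ - A₃ v₁ v₂ v₁) + (Ã₂ w₃ w₁ - A₂ v₃ v₁) + (Ã₂ w₂ w₂ - A₂ v₂ v₂)) +
        ((Ã₃ w₁ w₁ w₂ - A₃ v₁ v₁ v₂) + (Ã₂ w₂ w₂ - A₂ v₂ v₂) + (Ã₂ w₁ w₃ - A₂ v₁ v₃)) +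
        ((Ã₃ w₁ w₁ w₂ - A₃ v₁ v₁ v₂) + (Ã₂ w₂ w₂ - A₂ v₂ v₂) + (Ã₂ w₁ w₃ - A₂ v₁ v₃)) +
        (Ã₂ w₁ w₃ - A₂ v₁ v₃) + (Ã₁ r' - A₁ r) := by ring
  have hT := abs_add_le_add (abs_add_le_add (abs_add_le_add (abs_add_le_add (abs_add_le_add (abs_add_le_add
    (abs_add_le_add (abs_add_le_add t4 t3a) t3b) t3c) (abs_add_le_add (abs_add_le_add t3b t31) t22))
    (abs_add_le_add (abs_add_le_add t3c t22) t13)) (abs_add_le_add (abs_add_le_add t3c t22) t13)) t13) t1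
  rw [← e] at hT
  have hdd : |Ã₁ d - A₁ d| ≤ Δ₁ := by
    rw [← sub_apply]; exact (abs_apply_le_of_opNorm_le _ hΔ₁ _).trans (mul_le_of_le_one_right hΔ10 hd)
  have hs : |s| * |Ã₁ d - A₁ d| ≤ S * Δ₁ := mul_le_mul hS hdd (abs_nonneg _) ((abs_nonneg _).trans hS)
  refine hsol.trans (div_le_div_of_nonneg_right (add_le_add (hT.trans (le_of_eq ?_)) hs) hρ0.le)
  ring

end Algebra


/-! ## §2 Sizes and differences of the polar tower vectors (orders ≤ 3) and of the order-4 remainder -/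

section PolarVectors

variable {V : Type*} [NormedAddCommGroup V] [NormedSpace ℝ V] {d₀ d₁ : V} (hfc : ∀ a b : ℝ, ‖a • d₀ + b • d₁‖ ≤ |a| + |b|)
include hfc

/-- Sizes of the tower vectors `k₁, k₂, k₃` and of the order-4 remainder from `|u| ≤ U₀`, `|u′| ≤ R₁`, `|u″| ≤ R₂`, `|u‴| ≤ R₃`.
[folklore] -/
theorem polar_tower_norms_le {u₀ u₁ u₂ u₃ U₀ R₁ R₂ R₃ : ℝ} (h0 : |u₀| ≤ U₀) (h1 : |u₁| ≤ R₁) (h2 : |u₂| ≤ R₂) (h3 : |u₃| ≤ R₃) :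
    ‖u₁ • d₀ + u₀ • d₁‖ ≤ R₁ + U₀ ∧ ‖(u₂ - u₀) • d₀ + (2 * u₁) • d₁‖ ≤ R₂ + 2 * R₁ + U₀ ∧
      ‖(u₃ - 3 * u₁) • d₀ + (3 * u₂ - u₀) • d₁‖ ≤ R₃ + 3 * R₁ + 3 * R₂ + U₀ ∧
      ‖(-(6 * u₂) + u₀) • d₀ + (4 * u₃ - 4 * u₁) • d₁‖ ≤ 6 * R₂ + 4 * R₃ + 4 * R₁ + U₀ := by
  have a2 : |2 * u₁| ≤ 2 * R₁ := by rw [abs_mul, abs_two]; linarith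
  have b2 : |u₂ - u₀| ≤ R₂ + U₀ := (abs_sub _ _).trans (by linarith)
  have a3 : |u₃ - 3 * u₁| ≤ R₃ + 3 * R₁ := by
    refine (abs_sub _ _).trans ?_; rw [abs_mul, show |(3 : ℝ)| = 3 by norm_num]; linarith
  have b3 : |3 * u₂ - u₀| ≤ 3 * R₂ + U₀ := by
    refine (abs_sub _ _).trans ?_; rw [abs_mul, show |(3 : ℝ)| = 3 by norm_num]; linarith
  have a4 : |(-(6 * u₂) + u₀)| ≤ 6 * R₂ + U₀ := by
    refine (abs_add_le _ _).trans ?_; rw [abs_neg, abs_mul, show |(6 : ℝ)| = 6 by norm_num]; linarith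
  have b4 : |4 * u₃ - 4 * u₁| ≤ 4 * R₃ + 4 * R₁ := by
    refine (abs_sub _ _).trans ?_; rw [abs_mul, abs_mul, show |(4 : ℝ)| = 4 by norm_num]; linarith
  exact ⟨(hfc _ _).trans (by linarith), (hfc _ _).trans (by linarith), (hfc _ _).trans (by linarith), (hfc _ _).trans (by linarith)⟩

/-- Differences of the tower vectors and of the order-4 remainder for two towers from `|v⁽ⁱ⁾ − u⁽ⁱ⁾| ≤ W_i`. [folklore] -/
theorem polar_tower_norms_sub_le {u₀ u₁ u₂ u₃ v₀ v₁ v₂ v₃ W₀ W₁ W₂ W₃ : ℝ} (h0 : |v₀ - u₀| ≤ W₀) (h1 : |v₁ - u₁| ≤ W₁)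
    (h2 : |v₂ - u₂| ≤ W₂) (h3 : |v₃ - u₃| ≤ W₃) :
    ‖(v₁ • d₀ + v₀ • d₁) - (u₁ • d₀ + u₀ • d₁)‖ ≤ W₁ + W₀ ∧
      ‖((v₂ - v₀) • d₀ + (2 * v₁) • d₁) - ((u₂ - u₀) • d₀ + (2 * u₁) • d₁)‖ ≤ W₂ + 2 * W₁ + W₀ ∧
      ‖((v₃ - 3 * v₁) • d₀ + (3 * v₂ - v₀) • d₁) - ((u₃ - 3 * u₁) • d₀ + (3 * u₂ - u₀) • d₁)‖ ≤ W₃ + 3 * W₁ + 3 * W₂ + W₀ ∧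
      ‖((-(6 * v₂) + v₀) • d₀ + (4 * v₃ - 4 * v₁) • d₁) - ((-(6 * u₂) + u₀) • d₀ + (4 * u₃ - 4 * u₁) • d₁)‖ ≤
        6 * W₂ + 4 * W₃ + 4 * W₁ + W₀ := by
  have e1 : (v₁ • d₀ + v₀ • d₁) - (u₁ • d₀ + u₀ • d₁) = (v₁ - u₁) • d₀ + (v₀ - u₀) • d₁ := by rw [sub_smul, sub_smul]; abel
  have e2 : ((v₂ - v₀) • d₀ + (2 * v₁) • d₁) - ((u₂ - u₀) • d₀ + (2 * u₁) • d₁) =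
      ((v₂ - u₂) - (v₀ - u₀)) • d₀ + (2 * (v₁ - u₁)) • d₁ := by simp only [sub_smul, mul_sub]; abel
  have e3 : ((v₃ - 3 * v₁) • d₀ + (3 * v₂ - v₀) • d₁) - ((u₃ - 3 * u₁) • d₀ + (3 * u₂ - u₀) • d₁) =
      ((v₃ - u₃) - 3 * (v₁ - u₁)) • d₀ + (3 * (v₂ - u₂) - (v₀ - u₀)) • d₁ := by simp only [sub_smul, mul_sub]; abel
  have e4 : ((-(6 * v₂) + v₀) • d₀ + (4 * v₃ - 4 * v₁) • d₁) - ((-(6 * u₂) + u₀) • d₀ + (4 * u₃ - 4 * u₁) • d₁) =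
      (-(6 * (v₂ - u₂)) + (v₀ - u₀)) • d₀ + (4 * (v₃ - u₃) - 4 * (v₁ - u₁)) • d₁ := by
    simp only [sub_smul, add_smul, neg_smul, mul_sub]; abel
  obtain ⟨g1, g2, g3, g4⟩ := polar_tower_norms_le hfc h0 h1 h2 h3
  refine ⟨?_, ?_, ?_, ?_⟩
  · rw [e1]; exact (hfc _ _).trans (by linarith)
  · rw [e2]; simpa [sub_sub] using g2.trans (le_of_eq (by ring))
  · rw [e3]; exact g3.trans (le_of_eq (by ring))
  · rw [e4]; exact g4.trans (le_of_eq (by ring))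

end PolarVectors

/-! ## §3 Two polar level curves: order four -/

section TwoPolar

variable {e e' : (Fin 2 → ℝ) → ℝ} (he : ContDiff ℝ 4 e) (he' : ContDiff ℝ 4 e') {u v : ℝ → ℝ} (hu : ContDiff ℝ 4 u)
  (hv : ContDiff ℝ 4 v) {c c' : ℝ} (hlev : ∀ ϑ, e (u ϑ • dir ϑ) = c) (hlev' : ∀ ϑ, e' (v ϑ • dir ϑ) = c')
include he he' hu hv hlev hlev'

/-- **Order 4, two curves.**  At `θ`: transversality of the second curve `De′(ṽ)[dir θ] ≥ ρ₀ > 0`; sizes `‖Dᵏe(p)‖ ≤ E_k` (k ≤ 4);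
differences `‖Dᵏe′(ṽ) − Dᵏe(p)‖ ≤ Δ_k` (k ≤ 4); common tower bounds `U₀, R₁, R₂, R₃` for both curves and `|u⁗| ≤ R₄`; lower differences
`W₀, W₁, W₂, W₃`; with `K₁ = R₁+U₀`, `K₂ = R₂+2R₁+U₀`, `K₃ = R₃+3R₁+3R₂+U₀`, `δ₁ = W₁+W₀`, `δ₂ = W₂+2W₁+W₀`, `δ₃ = W₃+3W₁+3W₂+W₀`:
`|v⁗ − u⁗| ≤ (Δ₄K₁⁴ + 4E₄δ₁K₁³ + 6(Δ₃K₁²K₂ + E₃(δ₂K₁² + 2K₁K₂δ₁)) + 3(Δ₂K₂² + 2E₂K₂δ₂) + 4(Δ₂K₁K₃ + E₂(δ₁K₃ + K₁δ₃)) +`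
`Δ₁(6R₂+4R₃+4R₁+U₀) + E₁(6W₂+4W₃+4W₁+W₀) + R₄Δ₁)/ρ₀`. [cite: BenfattoGiulianiMastropietro2006, §2.4 Lemma 2.1 (2.40)] -/
theorem abs_deriv_four_sub_le_of_polar_levels {θ ρ₀ E₁ E₂ E₃ E₄ Δ₁ Δ₂ Δ₃ Δ₄ U₀ R₁ R₂ R₃ R₄ W₀ W₁ W₂ W₃ : ℝ} (hρ0 : 0 < ρ₀)
    (hρ' : ρ₀ ≤ fderiv ℝ e' (v θ • dir θ) (dir θ))
    (hE₁ : ‖fderiv ℝ e (u θ • dir θ)‖ ≤ E₁) (hE₂ : ‖fderiv ℝ (fderiv ℝ e) (u θ • dir θ)‖ ≤ E₂)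
    (hE₃ : ‖fderiv ℝ (fderiv ℝ (fderiv ℝ e)) (u θ • dir θ)‖ ≤ E₃)
    (hE₄ : ‖fderiv ℝ (fderiv ℝ (fderiv ℝ (fderiv ℝ e))) (u θ • dir θ)‖ ≤ E₄)
    (hΔ₁ : ‖fderiv ℝ e' (v θ • dir θ) - fderiv ℝ e (u θ • dir θ)‖ ≤ Δ₁)
    (hΔ₂ : ‖fderiv ℝ (fderiv ℝ e') (v θ • dir θ) - fderiv ℝ (fderiv ℝ e) (u θ • dir θ)‖ ≤ Δ₂)
    (hΔ₃ : ‖fderiv ℝ (fderiv ℝ (fderiv ℝ e')) (v θ • dir θ) - fderiv ℝ (fderiv ℝ (fderiv ℝ e)) (u θ • dir θ)‖ ≤ Δ₃)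
    (hΔ₄ : ‖fderiv ℝ (fderiv ℝ (fderiv ℝ (fderiv ℝ e'))) (v θ • dir θ) -
        fderiv ℝ (fderiv ℝ (fderiv ℝ (fderiv ℝ e))) (u θ • dir θ)‖ ≤ Δ₄)
    (hU₀ : |u θ| ≤ U₀) (hU₀' : |v θ| ≤ U₀) (hR₁ : |deriv u θ| ≤ R₁) (hR₁' : |deriv v θ| ≤ R₁)
    (hR₂ : |deriv (deriv u) θ| ≤ R₂) (hR₂' : |deriv (deriv v) θ| ≤ R₂)
    (hR₃ : |deriv (deriv (deriv u)) θ| ≤ R₃) (hR₃' : |deriv (deriv (deriv v)) θ| ≤ R₃)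
    (hR₄ : |deriv (deriv (deriv (deriv u))) θ| ≤ R₄)
    (hW₀ : |v θ - u θ| ≤ W₀) (hW₁ : |deriv v θ - deriv u θ| ≤ W₁) (hW₂ : |deriv (deriv v) θ - deriv (deriv u) θ| ≤ W₂)
    (hW₃ : |deriv (deriv (deriv v)) θ - deriv (deriv (deriv u)) θ| ≤ W₃) :
    |deriv (deriv (deriv (deriv v))) θ - deriv (deriv (deriv (deriv u))) θ| ≤
      (Δ₄ * (R₁ + U₀) ^ 4 + 4 * E₄ * (W₁ + W₀) * (R₁ + U₀) ^ 3 +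
        6 * (Δ₃ * (R₁ + U₀) ^ 2 * (R₂ + 2 * R₁ + U₀) +
          E₃ * ((W₂ + 2 * W₁ + W₀) * (R₁ + U₀) ^ 2 + 2 * (R₁ + U₀) * (R₂ + 2 * R₁ + U₀) * (W₁ + W₀))) +
        3 * (Δ₂ * (R₂ + 2 * R₁ + U₀) ^ 2 + 2 * E₂ * (R₂ + 2 * R₁ + U₀) * (W₂ + 2 * W₁ + W₀)) +
        4 * (Δ₂ * (R₁ + U₀) * (R₃ + 3 * R₁ + 3 * R₂ + U₀) +
          E₂ * ((W₁ + W₀) * (R₃ + 3 * R₁ + 3 * R₂ + U₀) + (R₁ + U₀) * (W₃ + 3 * W₁ + 3 * W₂ + W₀))) +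
        Δ₁ * (6 * R₂ + 4 * R₃ + 4 * R₁ + U₀) + E₁ * (6 * W₂ + 4 * W₃ + 4 * W₁ + W₀) + R₄ * Δ₁) / ρ₀ := by
  have hid := level_chain_four (k₀ := fun t => u t • dir t) he hlev (hasDerivAt_polar_zero hu)
    (hasDerivAt_polar_one hu) (hasDerivAt_polar_two hu) (hasDerivAt_polar_three hu) θ
  have hid' := level_chain_four (k₀ := fun t => v t • dir t) he' hlev' (hasDerivAt_polar_zero hv)
    (hasDerivAt_polar_one hv) (hasDerivAt_polar_two hv) (hasDerivAt_polar_three hv) θ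
  set A₁ := fderiv ℝ e (u θ • dir θ) with hA₁
  set Ã₁ := fderiv ℝ e' (v θ • dir θ) with hÃ₁
  set A₂ := fderiv ℝ (fderiv ℝ e) (u θ • dir θ) with hA₂
  set Ã₂ := fderiv ℝ (fderiv ℝ e') (v θ • dir θ) with hÃ₂
  set A₃ := fderiv ℝ (fderiv ℝ (fderiv ℝ e)) (u θ • dir θ) with hA₃
  set Ã₃ := fderiv ℝ (fderiv ℝ (fderiv ℝ e')) (v θ • dir θ) with hÃ₃
  set A₄ := fderiv ℝ (fderiv ℝ (fderiv ℝ (fderiv ℝ e))) (u θ • dir θ) with hA₄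
  set Ã₄ := fderiv ℝ (fderiv ℝ (fderiv ℝ (fderiv ℝ e'))) (v θ • dir θ) with hÃ₄
  set d₀ := dir θ with hd₀
  set d₁ := dir (θ + π / 2) with hd₁
  clear_value A₁ Ã₁ A₂ Ã₂ A₃ Ã₃ A₄ Ã₄
  have hfc : ∀ a b : ℝ, ‖a • d₀ + b • d₁‖ ≤ |a| + |b| := fun a b => by rw [hd₀, hd₁]; exact norm_frame_comb_le a b θ
  clear_value d₀ d₁
  have hnd₀ : ‖d₀‖ ≤ 1 := hd₀ ▸ norm_dir_le_one _
  -- sizes and differences of the tower vectors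
  obtain ⟨hK₁, hK₂, hK₃, -⟩ := polar_tower_norms_le hfc hU₀ hR₁ hR₂ hR₃
  obtain ⟨hK₁', hK₂', hK₃', hL⟩ := polar_tower_norms_le hfc hU₀' hR₁' hR₂' hR₃'
  obtain ⟨hδ₁, hδ₂, hδ₃, hdL⟩ := polar_tower_norms_sub_le hfc hW₀ hW₁ hW₂ hW₃
  have hv4 : (deriv (deriv (deriv (deriv u))) θ - 6 * deriv (deriv u) θ + u θ) • d₀ +
        (4 * deriv (deriv (deriv u)) θ - 4 * deriv u θ) • d₁ =
      deriv (deriv (deriv (deriv u))) θ • d₀ +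
        ((-(6 * deriv (deriv u) θ) + u θ) • d₀ + (4 * deriv (deriv (deriv u)) θ - 4 * deriv u θ) • d₁) := by
    simp only [sub_smul, add_smul, neg_smul]; abel
  have hw4 : (deriv (deriv (deriv (deriv v))) θ - 6 * deriv (deriv v) θ + v θ) • d₀ +
        (4 * deriv (deriv (deriv v)) θ - 4 * deriv v θ) • d₁ =
      deriv (deriv (deriv (deriv v))) θ • d₀ +
        ((-(6 * deriv (deriv v) θ) + v θ) • d₀ + (4 * deriv (deriv (deriv v)) θ - 4 * deriv v θ) • d₁) := by
    simp only [sub_smul, add_smul, neg_smul]; abel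
  exact (abs_top_sub_top_le_of_level_four hid hid' hv4 hw4 hρ' hρ0 hnd₀ hE₁ hE₂ hE₃ hE₄ hΔ₁ hΔ₂ hΔ₃ hΔ₄ hK₁ hK₁' hK₂ hK₂'
    hK₃ hK₃' hδ₁ hδ₂ hδ₃ hL hdL hR₄).trans (le_of_eq (by ring))

end TwoPolar

end Summit.HubbardSuperconductivity.HubbardSuperconductivity.Theorems.PerturbedFermiCurve

end
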